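import Mathlib
import HarnessLib
import Literature.NumberTheory.LFunctions.ZetaScrew

/-!
# Route `IntegerScrew` — definitions: the NESTED screw Gram matrices `S_M` and their LDLᵀ pivots

Route `RiemannHypothesis/IntegerScrew` (target item stmt-RiemannHypothesis-15756, `IntegerScrewPSD`).
The route file states everything as real quadratic forms `∑_{2≤m,m'≤M} G(log m, log m') x_m x_m'`
of Suzuki's kernel `G(t,u) = Ψ(t) + Ψ(u) − Ψ(t − u)`
(`Literature.NumberTheory.LFunctions.zetaScrewKernel`, Suzuki2023 (1.4) for `g = −Ψ`). This file
names the MATRICES behind those forms and the objects of the numerical programme built on them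
(certified `λ_min(S_M)`, pivot ladders), so that statements about them can be typed:

* `IntegerScrew.screwMatrix n` — the `n × n` real symmetric matrix
  `[G(log(i+2), log(j+2))]_{0 ≤ i,j < n}`, i.e. the Gram matrix `S_M` of the kernel on the nodes
  `log 2 < log 3 < ⋯ < log M` with `M = n + 1` (row `i ↔ m = i + 2`; the node `log 1 = 0` is omitted
  because `G(0,·) ≡ 0`, `zetaScrewKernel_zero_left`). `S_M = screwMatrix (M − 1)`;
  `screwMatrix 0` is the empty matrix, `screwMatrix 1 = [2Ψ(log 2)]`.
* `IntegerScrew.screwDet n = det (screwMatrix n)` (so `det S_M = screwDet (M − 1)`, `screwDet 0 = 1`).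
* `IntegerScrew.screwPivot M = det S_M / det S_{M−1} = screwDet (M − 1) / screwDet (M − 2)` — the
  `M`-th PIVOT `d_M` of the LDLᵀ (Cholesky) factorisation of the nested family in the natural order,
  equivalently the Schur complement of `S_{M−1}` in `S_M`, equivalently (when `S_{M−1} ≻ 0`) the
  squared distance of the point `x_{log M}` of Kreĭn's screw line from the span of
  `x_{log 2}, …, x_{log(M−1)}`. `screwPivot 2 = 2Ψ(log 2)`; for `M < 2` the value is the junk `1`.
* `IntegerScrew.screwBorder n`, `IntegerScrew.screwCorner n` — the last column
  `[G(log(i+2), log(n+2))]_i` and the corner `[G(log(n+2), log(n+2))] = [2Ψ(log(n+2))]` of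
  `S_{n+2}`, i.e. the blocks of the bordering `S_{n+2} = [[S_{n+1}, b], [bᵀ, c]]`
  (`IntegerScrewPivotCriterion.screwMatrix_succ_submatrix`).

Nothing here is progress on `ζ`: these are names. The theorems about them
(`RH ↔ ∀ n, (screwMatrix n).PosSemidef ↔ ∀ n, (screwMatrix n).PosDef ↔ ∀ M ≥ 2, 0 < screwPivot M`)
are in `Theorems/IntegerScrewPivotCriterion.lean`. Reference for the kernel and its RH-criterion on
ALL real configurations: M. Suzuki, J. Lond. Math. Soc. (2) 108 (2023) 1448–1487 = arXiv:2206.03682,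
(1.1), (1.4), (1.5), Thm 1.2 [Suzuki2023]; the restriction to the nodes `log m` is the route's, not
Suzuki's.
-/

noncomputable section

-- D-0017: `Summit.<S>.<S>.…` is the designed namespace of a single-problem summit.
set_option linter.dupNamespace false

namespace Summit.RiemannHypothesis.RiemannHypothesis.Theorems.IntegerScrew

open Literature.NumberTheory.LFunctions

/-- The `n × n` SCREW GRAM MATRIX on the nodes `log 2, …, log(n+1)`:
`screwMatrix n i j = G(log(i+2), log(j+2)) = Ψ(log(i+2)) + Ψ(log(j+2)) − Ψ(log((i+2)/(j+2)))`
(`G = zetaScrewKernel`, Suzuki2023 (1.4) with `g = −Ψ`). In the route's notation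
`S_M = [G(log m, log m')]_{2 ≤ m,m' ≤ M} = screwMatrix (M − 1)` (row `i ↔ m = i + 2`).
[cite: Suzuki2023, (1.4)–(1.5)] -/
def screwMatrix (n : ℕ) : Matrix (Fin n) (Fin n) ℝ :=
  Matrix.of fun i j =>
    zetaScrewKernel (Real.log (((i : ℕ) + 2 : ℕ) : ℝ)) (Real.log (((j : ℕ) + 2 : ℕ) : ℝ))

/-- `screwDet n = det (screwMatrix n)`, the leading principal minor `det S_{n+1}` of the nested
family (`screwDet 0 = 1`, the empty determinant). [folklore] -/
def screwDet (n : ℕ) : ℝ :=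
  (screwMatrix n).det

/-- The `M`-th LDLᵀ PIVOT of the nested screw matrices,
`screwPivot M = d_M := det S_M / det S_{M−1} = screwDet (M − 1) / screwDet (M − 2)`:
`screwPivot 2 = det S_2 = 2Ψ(log 2)`, and for `M ≥ 3` the Schur complement of `S_{M−1}` in `S_M`
whenever `det S_{M−1} ≠ 0` (natural-number subtraction makes `screwPivot 0 = screwPivot 1 = 1`,
junk values never used). [folklore] -/
def screwPivot (M : ℕ) : ℝ :=
  screwDet (M - 1) / screwDet (M - 2)

/-- The BORDER COLUMN of `S_{n+2}`: `screwBorder n i 0 = G(log(i+2), log(n+2))`, `i < n`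
(a `Fin n × Fin 1` matrix). [folklore] -/
def screwBorder (n : ℕ) : Matrix (Fin n) (Fin 1) ℝ :=
  Matrix.of fun i _ =>
    zetaScrewKernel (Real.log (((i : ℕ) + 2 : ℕ) : ℝ)) (Real.log ((n + 2 : ℕ) : ℝ))

/-- The CORNER of `S_{n+2}`: the `1 × 1` matrix `[G(log(n+2), log(n+2))] = [2Ψ(log(n+2))]`.
[folklore] -/
def screwCorner (n : ℕ) : Matrix (Fin 1) (Fin 1) ℝ :=
  Matrix.of fun _ _ =>
    zetaScrewKernel (Real.log ((n + 2 : ℕ) : ℝ)) (Real.log ((n + 2 : ℕ) : ℝ))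

end Summit.RiemannHypothesis.RiemannHypothesis.Theorems.IntegerScrew
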